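/-
Copyright (c) 2026 the pub-hodgecm-mathlib formalisation cell (harness21).  Prover seat hodgecm-mathlib-F0P2-p10 (g3), Track B «K2-LIT»,
#184♮ = hLiu418 = `stmt-HodgeConjecture-24832`; LEAD F0P6-plan (g15) BATCH #229 [A1-mat] (RULING M-160f, (σ-A) mini-road, brick [A1] = K2Liu-p09 (g9)
`K2LiuLocalSWCornerActionWords`); (σ-A) road desk K2Liu-p25 (g3).  THEOREMS ONLY (no `def`, no `instance`, no notation, no named-fact hypothesis, no `sorry`).
-/
import Summits.HodgeConjecture.HodgeConjecture.Theorems.K2LiuDoubledUTwoTwoLetterTransport    -- ★ B1b-2c: `reindex_uMinus`∕`reindex_weylOne`, `isSiegelDelta_∕blocks_∕localSiegelCharacter_frameConj_{uMinus,weylOne}` (⇒ LeviTransport, B1a, B1b-1)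
import Summits.HodgeConjecture.HodgeConjecture.Theorems.K2LiuUnipDeltaLocalCoordinates          -- ★ `skew_blkB_of_mem_unipDeltaLocal`, `eq_nElem_of_mem_unipDeltaLocal`
import HarnessLib

/-!
# Crux `HLiu418`, road `K2_Liu`, (σ-A) brick [A1-mat] — `K2LiuLocalFourCornerFactorisation`: THE FOUR CORNER ELEMENTS OF ★ p863595's STAGE CURRENCY
# IN THE `Δ`-ADAPTED FRAME OF `H_v` — `u_{2e₂}` IS A SIEGEL UNIPOTENT `n(t)`, `u_{e₁−e₂}` AND `w₁` ARE SIEGEL-LEVI LETTERS, `w₂` IS THE RANK-ONE CELL (FLIP × LEVI)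

Cell `hodgecm-mathlib`, crux item hLiu418 = `stmt-HodgeConjecture-24832` (helper lane `--supports … --as helper`, count-neutral), route of record
`HCCMUnconditional`; squad K2 ∕ K2Liu; prover F0P2-p10 (g3).

WHY.  The (K1a-3) stage letters `N₁ N₂` and the bad-place factor `W = Gn′(½, h)` of ★ p863595 `K2LiuRankOneStagePlaceLetterValues.chainValues_of_placeLetter`
read the FLAT Siegel family `f s` at the four CORNER ELEMENTS `φ(X) := frameConj F E c v (2+2) hJ₂D (antidiagonal_over_eq_map F E 2) Q hQ (toLocalFour F E c v X)`,
`X ∈ {weylTwo, uLongTwo (yδ), weylOne, uMinus (ζ e_w)}` (★ B1a `K2LiuDoubledUTwoTwoBorelFrame` ∕ `…WeylCocycle`), of the local doubled group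
`H_v = UnitaryGroup.localPi E c (2+2) J₂D v`.  The (σ-A) brick [A1] (K2Liu-p09) wants the Schrödinger-model action of each `φ(X)`; every ★ operator word
(★ F4a `K2LiuLocalSWBigCellWords.implementer_localOmega_nElem_apply` on `nElem t ht`, ★ `K2LiuBlockImplementerLeviAction` ∕ `K2LiuLocalSWLeviScalars` on
`IsSiegelDelta p` + blocks, ★ F6 `K2LiuLocalSWMiddleCell*` ∕ ★ `K2LiuLocalSWFlipElements` on a FLIP `adapt (matA w₁) = [[1−P, P], [P, 1−P]]`) is keyed on the
`Δ`-ADAPTED MATRIX `adapt (matA x)` (★ `LocalDoubledUnitaryLagrangians.matA`, ★ `AdaptedBlocks.adapt`).  This file computes it for the four corners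
(★ B1b-1 `adapt_matA_frameConj`: the transport is conjugation by `diag(1, D_v)`) and names the Siegel piece each corner IS:
* §0 (in `U(J₄)(R, σ)`) `uLongTwo_eq_nSiegel` (`u_{2e₂}(x) = n(x,0,0)`), `uMinus_eq_leviElt` (`u_{e₁−e₂}(z) = m((1 z; 0 1))`; `w₁ = m(antidiag)` is ★ `leviElt_eq_weylOne`),
  and the `Fin 2 ⊕ Fin 2`-blocked matrices of `u_{2e₂}`, `w₂` (`u_{e₁−e₂}`, `w₁`: ★ B1b-2c `K2LiuDoubledUTwoTwoLetterTransport.reindex_uMinus∕reindex_weylOne`);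
* §1 **`adapt_matA_frameConj_uLongTwo = (1, E₂₁(x)·Dinv_v; 0, 1)`**, `frameConj_uLongTwo_mem_unipDeltaLocal`, **`frameConj_uLongTwo_eq_nElem`** (the `nElem t ht` token);
* §2 **`adapt_matA_frameConj_uMinus = diag((1 z; 0 1), D_v (1 −σz; 0 1) Dinv_v)`**, **`adapt_matA_frameConj_weylOne = diag(W, D_v W Dinv_v)`** and `det_Δ` (`= 1`, `= −1`);
  the blocks, the `P_Δ`-membership and the inducing character of these two are ALREADY ★ B1b-2c `K2LiuDoubledUTwoTwoLetterTransport.{blocks_matA_,isSiegelDelta_,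
  localSiegelCharacter_}frameConj_{uMinus,weylOne}` (cited, not restated);
* §3 **`adapt_matA_frameConj_weylTwo = ((E₁₁, E₂₁ Dinv_v), (D_v E₁₂, D_v E₂₂ Dinv_v))`** (general `D`: the RANK-ONE cell, `C = D_v E₁₂`), and at an ANTIDIAGONAL frame
  `D = (0 d₁; d₂ 0)`, `Dinv = (0 e₁; e₂ 0)` (the shape `D = ½T₂⁻¹W` has for DIAGONAL `T₂`): **`… = [[1−P, e₁P], [d₂P, 1−P]]`, `P = E₂₂`**, i.e. for ANY flip `w₁` of the
  second line (`adapt (matA w₁) = [[1−P, P], [P, 1−P]]`, ★ `exists_flip_single (i := 1)`): `w₁ · w₁ = 1` and **`adapt (matA (w₁ · φ(w₂))) = diag(1−P+d₂P, 1−P+e₁P)`** —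
  `φ(w₂) = w₁ · m` with `m` an explicit diagonal LEVI element (`IsSiegelDelta`, `B = 0`).
[HarrisKudlaSweet1996, §1 (1.11)–(1.12), (1.15)] [Kudla1994, §3] [Casselman1980, §3].
HONEST LABEL.  Count-neutral helper, closes no socket by itself: `HC_CM` is proved only modulo the 7 printed citations (2 remaining named inputs: hLiu418 =
`stmt-HodgeConjecture-24832`, h413 = `stmt-HodgeConjecture-24833`) until rung 0 closes.

## References
* [HarrisKudlaSweet1996] M. Harris, S. Kudla, W. J. Sweet, J. AMS 9 (1996): §1 (1.11)–(1.12), (1.15).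
* [Kudla1994] S. Kudla, Israel J. Math. 87 (1994): §3.   * [Casselman1980] W. Casselman, Compositio Math. 40 (1980): §3.
-/

set_option autoImplicit false
set_option linter.dupNamespace false -- the mandated namespace repeats `HodgeConjecture.HodgeConjecture`

noncomputable section

open NumberField IsDedekindDomain Matrix
open Literature.NumberTheory.Automorphic Literature.NumberTheory.Automorphic.UnitaryGroup
open Literature.NumberTheory.GelbartRogawski1991.AdaptedBlocks
open Literature.NumberTheory.GelbartRogawski1991.UnitaryDualPair.LocalSplitting
open Literature.NumberTheory.K2Lit.LocalSiegelDoubled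
open Summit.HodgeConjecture.HodgeConjecture.Cruxes.HLiu418.K2LiuLocalSiegelIwasawa
open Summit.HodgeConjecture.HodgeConjecture.Cruxes.HLiu418.K2LiuDoubledUTwoTwoBorelFrame
open Summit.HodgeConjecture.HodgeConjecture.Cruxes.HLiu418.K2LiuDoubledUTwoTwoWeylCocycle
open Summit.HodgeConjecture.HodgeConjecture.Cruxes.HLiu418.K2LiuDoubledUTwoTwoLevi
open Summit.HodgeConjecture.HodgeConjecture.Cruxes.HLiu418.K2LiuDoubledUTwoTwoFrameTransport
open Summit.HodgeConjecture.HodgeConjecture.Cruxes.HLiu418.K2LiuDoubledUTwoTwoLeviTransport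
open Summit.HodgeConjecture.HodgeConjecture.Cruxes.HLiu418.K2LiuDoubledUTwoTwoLetterTransport
open Summit.HodgeConjecture.HodgeConjecture.Cruxes.HLiu418.K2LiuSiegelLeviWeylAlgebra
open Summit.HodgeConjecture.HodgeConjecture.Cruxes.HLiu418.K2LiuUnipDeltaLocalCoordinates

namespace Summit.HodgeConjecture.HodgeConjecture.Cruxes.HLiu418.K2LiuLocalFourCornerFactorisation

/-! ## §0 Inside `U(J₄)(R, σ)`: the corner letters as Siegel pieces, and their blocked matrices -/

section Letters

variable (R : Type*) [CommRing R] (σ : R →+* R)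

/-- **`u_{2e₂}(x) = n(x, 0, 0)`**: the long-root letter is the Siegel unipotent with `X = (0 0; x 0)` (rank one). [cite: HarrisKudlaSweet1996, §1 (1.11)] -/
theorem uLongTwo_eq_nSiegel (hσ : ∀ x, σ (σ x) = x) (x : R) (hx : σ x = -x) :
    uLongTwo R σ x hx = nSiegel R σ hσ x 0 0 hx (by rw [map_zero, neg_zero]) := by
  apply ext_of_coe
  rw [coe_uLongTwo, coe_nSiegel]
  ext i j
  fin_cases i <;> fin_cases j <;> simp [uLongTwoM, nSiegelM]

/-- **`u_{e₁−e₂}(z) = m((1 z; 0 1))`**: the short-root letter is the Siegel-Levi letter of the upper unipotent of `GL₂` (for any `A ∈ GL₂(R)` with that matrix).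
[cite: HarrisKudlaSweet1996, §1 (1.11)] [cite: Casselman1980, §3] -/
theorem uMinus_eq_leviElt (hσ : ∀ x, σ (σ x) = x) (z : R) (A : GL (Fin 2) R) (hA : (A : Matrix (Fin 2) (Fin 2) R) = !![1, z; 0, 1]) :
    uMinus R σ hσ z = leviElt R σ hσ A := by
  have hAi : (A : Matrix (Fin 2) (Fin 2) R)⁻¹ = !![1, -z; 0, 1] := by
    rw [hA]
    refine Matrix.inv_eq_left_inv ?_
    ext i j; fin_cases i <;> fin_cases j <;> simp [Matrix.mul_apply, Fin.sum_univ_two]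
  apply ext_of_coe
  rw [coe_leviElt, coe_uMinus]
  unfold leviM
  rw [hAi, hA]
  ext i j
  fin_cases i <;> fin_cases j <;> simp [uMinusM]

end Letters

variable (F : Type) [Field F] [NumberField F] (E : Type) [Field E] [NumberField E] [Algebra F E]
  [Algebra.IsQuadraticExtension F E] (c : E ≃ₐ[F] E)
  {δ : E} (hcδ : c δ = -δ) (hδ : δ ≠ 0) {d : F} (hd : δ * δ = algebraMap F E d) (v : HeightOneSpectrum (𝓞 F))
  {T₂ : Matrix (Fin 2) (Fin 2) F} (hT₂ : T₂.IsSymm) {J₂D : Matrix (Fin (2 + 2)) (Fin (2 + 2)) E} (hJ₂D : J₂D = (gramD F 2 T₂).map (algebraMap F E))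
  (D Dinv : Matrix (Fin 2) (Fin 2) F) (hDD : D * Dinv = 1) (Q : GL (Fin (2 + 2)) F)
  (hQm : (Q : Matrix (Fin (2 + 2)) (Fin (2 + 2)) F) = Matrix.reindex (e₂ 2) (e₂ 2) (Matrix.fromBlocks 1 D 1 (-D)))
  (hQ : (Q : Matrix (Fin (2 + 2)) (Fin (2 + 2)) F)ᵀ * gramD F 2 T₂ * (Q : Matrix (Fin (2 + 2)) (Fin (2 + 2)) F) = (StdForm.antidiagonal (2 + 2)).over F)

omit [Algebra.IsQuadraticExtension F E] in
/-- blocked matrix of `u_{2e₂}(x)`: `(1, E₂₁(x); 0, 1)`. [cite: HarrisKudlaSweet1996, §1 (1.11)] -/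
theorem reindex_uLongTwo (x : UnitaryGroup.LocalRing E v) (hx : UnitaryGroup.conjLocal E c v x = -x) :
    Matrix.reindex (e₂ 2).symm (e₂ 2).symm
        ((uLongTwo (UnitaryGroup.LocalRing E v) (UnitaryGroup.conjLocal E c v) x hx : unitaryGroupOfForm _ _) : GL (Fin 4) (UnitaryGroup.LocalRing E v)).1 =
      Matrix.fromBlocks 1 !![0, 0; x, 0] 0 1 := by
  rw [coe_uLongTwo]
  ext i j
  rcases i with i | i <;> rcases j with j | j <;> fin_cases i <;> fin_cases j <;> rfl

omit [Algebra.IsQuadraticExtension F E] in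
/-- blocked matrix of `w₂`: `((E₁₁, E₂₁), (E₁₂, E₂₂))` — it swaps the second `Δ`-coordinate with the first `Δ⁻`-coordinate. [cite: Casselman1980, §3] -/
theorem reindex_weylTwo :
    Matrix.reindex (e₂ 2).symm (e₂ 2).symm
        ((weylTwo (UnitaryGroup.LocalRing E v) (UnitaryGroup.conjLocal E c v) : unitaryGroupOfForm _ _) : GL (Fin 4) (UnitaryGroup.LocalRing E v)).1 =
      Matrix.fromBlocks !![1, 0; 0, 0] !![0, 0; 1, 0] !![0, 1; 0, 0] !![0, 0; 0, 1] := by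
  rw [coe_weylTwo]
  ext i j
  rcases i with i | i <;> rcases j with j | j <;> fin_cases i <;> fin_cases j <;> rfl

/-! ## §1 `φ(u_{2e₂}(x))` is the Siegel unipotent `n(E₂₁(x) · Dinv_v)` -/

omit [Algebra.IsQuadraticExtension F E] in
include hJ₂D hDD hQm in
/-- **`adapt (matA (φ(u_{2e₂}(x)))) = (1, E₂₁(x)·Dinv_v; 0, 1)`**. [cite: HarrisKudlaSweet1996, §1 (1.11)] -/
theorem adapt_matA_frameConj_uLongTwo (x : UnitaryGroup.LocalRing E v) (hx : UnitaryGroup.conjLocal E c v x = -x) :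
    adapt (matA F E c v 2 (FrameTransport.frameConj F E c v (2 + 2) hJ₂D (antidiagonal_over_eq_map F E 2) Q hQ
        (toLocalFour F E c v (uLongTwo (UnitaryGroup.LocalRing E v) (UnitaryGroup.conjLocal E c v) x hx)))) =
      Matrix.fromBlocks 1 (!![0, 0; x, 0] * Dinv.map ((UnitaryGroup.toLocalRing E v).comp (algebraMap F (v.adicCompletion F)))) 0 1 := by
  rw [adapt_matA_frameConj F E c v 2 hJ₂D D Dinv hDD Q hQm hQ, matS_toLocalFour, reindex_uLongTwo, Matrix.fromBlocks_multiply,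
    Matrix.fromBlocks_multiply]
  simp only [Matrix.mul_one, Matrix.one_mul, Matrix.mul_zero, Matrix.zero_mul, add_zero, zero_add, map_D_mul_map_Dinv F E v D Dinv hDD]

omit [Algebra.IsQuadraticExtension F E] in
include hJ₂D hDD hQm in
/-- **`φ(u_{2e₂}(x)) ∈ N_Δ(F_v)`**. [cite: HarrisKudlaSweet1996, §1 (1.11)] -/
theorem frameConj_uLongTwo_mem_unipDeltaLocal (x : UnitaryGroup.LocalRing E v) (hx : UnitaryGroup.conjLocal E c v x = -x) :
    FrameTransport.frameConj F E c v (2 + 2) hJ₂D (antidiagonal_over_eq_map F E 2) Q hQ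
        (toLocalFour F E c v (uLongTwo (UnitaryGroup.LocalRing E v) (UnitaryGroup.conjLocal E c v) x hx)) ∈ unipDeltaLocal F E c v 2 (JD := J₂D) :=
  ⟨_, adapt_matA_frameConj_uLongTwo F E c v hJ₂D D Dinv hDD Q hQm hQ x hx⟩

omit [Algebra.IsQuadraticExtension F E] in
include hJ₂D hDD hQm in
/-- the `B`-block of `φ(u_{2e₂}(x))` is `E₂₁(x)·Dinv_v`. [cite: HarrisKudlaSweet1996, §1 (1.11)] -/
theorem blkB_matA_frameConj_uLongTwo (x : UnitaryGroup.LocalRing E v) (hx : UnitaryGroup.conjLocal E c v x = -x) :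
    blkB (matA F E c v 2 (FrameTransport.frameConj F E c v (2 + 2) hJ₂D (antidiagonal_over_eq_map F E 2) Q hQ
        (toLocalFour F E c v (uLongTwo (UnitaryGroup.LocalRing E v) (UnitaryGroup.conjLocal E c v) x hx)))) =
      !![0, 0; x, 0] * Dinv.map ((UnitaryGroup.toLocalRing E v).comp (algebraMap F (v.adicCompletion F))) := by
  have h := adapt_matA_frameConj_uLongTwo F E c v hJ₂D D Dinv hDD Q hQm hQ x hx
  rw [adapt_eq] at h
  exact (Matrix.fromBlocks_inj.1 h).2.1

omit [Algebra.IsQuadraticExtension F E] in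
include hJ₂D hDD Q hQm hQ in
/-- `E₂₁(x)·Dinv_v` is `T₂`-skew (it is the `B`-block of an element of `N_Δ(F_v)`, ★ `skew_blkB_of_mem_unipDeltaLocal`). [cite: HarrisKudlaSweet1996, §1 (1.12)] -/
theorem skew_uLongTwoBlock (x : UnitaryGroup.LocalRing E v) (hx : UnitaryGroup.conjLocal E c v x = -x) :
    ((!![0, 0; x, 0] * Dinv.map ((UnitaryGroup.toLocalRing E v).comp (algebraMap F (v.adicCompletion F)))).map (UnitaryGroup.conjLocal E c v))ᵀ *
          gramS F E v 2 T₂ +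
        gramS F E v 2 T₂ * (!![0, 0; x, 0] * Dinv.map ((UnitaryGroup.toLocalRing E v).comp (algebraMap F (v.adicCompletion F)))) = 0 := by
  rw [← blkB_matA_frameConj_uLongTwo F E c v hJ₂D D Dinv hDD Q hQm hQ x hx]
  exact skew_blkB_of_mem_unipDeltaLocal F E c v 2 hJ₂D (frameConj_uLongTwo_mem_unipDeltaLocal F E c v hJ₂D D Dinv hDD Q hQm hQ x hx)

omit [Algebra.IsQuadraticExtension F E] in
include hDD hQm in
/-- **`φ(u_{2e₂}(x)) = n(E₂₁(x)·Dinv_v)`** — the ★ `nElem t ht` token the Schrödinger-model unipotent word (★ F4a `implementer_localOmega_nElem_apply`) consumes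
(any other skewness witness fits by ★ `nElem_congr`). [cite: HarrisKudlaSweet1996, §1 (1.11)] [cite: Kudla1994, §3] -/
theorem frameConj_uLongTwo_eq_nElem (x : UnitaryGroup.LocalRing E v) (hx : UnitaryGroup.conjLocal E c v x = -x) :
    FrameTransport.frameConj F E c v (2 + 2) hJ₂D (antidiagonal_over_eq_map F E 2) Q hQ
        (toLocalFour F E c v (uLongTwo (UnitaryGroup.LocalRing E v) (UnitaryGroup.conjLocal E c v) x hx)) =
      nElem F E c v 2 hJ₂D (!![0, 0; x, 0] * Dinv.map ((UnitaryGroup.toLocalRing E v).comp (algebraMap F (v.adicCompletion F))))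
        (skew_uLongTwoBlock F E c v hJ₂D D Dinv hDD Q hQm hQ x hx) := by
  refine matA_injective F E c v 2 (eq_of_adapt_eq ?_)
  rw [adapt_matA_nElem, adapt_matA_frameConj_uLongTwo F E c v hJ₂D D Dinv hDD Q hQm hQ x hx]

/-! ## §2 `φ(u_{e₁−e₂}(z))` and `φ(w₁)` are Siegel-Levi letters -/

include hJ₂D hDD hQm in
/-- **`adapt (matA (φ(u_{e₁−e₂}(z)))) = diag((1 z; 0 1), D_v (1 −σz; 0 1) Dinv_v)`**. [cite: HarrisKudlaSweet1996, §1 (1.11)] -/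
theorem adapt_matA_frameConj_uMinus (z : UnitaryGroup.LocalRing E v) :
    adapt (matA F E c v 2 (FrameTransport.frameConj F E c v (2 + 2) hJ₂D (antidiagonal_over_eq_map F E 2) Q hQ
        (toLocalFour F E c v (uMinus (UnitaryGroup.LocalRing E v) (UnitaryGroup.conjLocal E c v) (UnitaryGroup.conjLocal_conjLocal c v hcδ hδ) z)))) =
      Matrix.fromBlocks !![1, z; 0, 1] 0 0
        (D.map ((UnitaryGroup.toLocalRing E v).comp (algebraMap F (v.adicCompletion F))) * !![1, -UnitaryGroup.conjLocal E c v z; 0, 1] *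
          Dinv.map ((UnitaryGroup.toLocalRing E v).comp (algebraMap F (v.adicCompletion F)))) :=
  adapt_matA_frameConj_of_blocks F E c v hJ₂D D Dinv hDD Q hQm hQ _ _ _ (reindex_uMinus F E c hcδ hδ v z)

include hJ₂D hDD hQm in
/-- **`det_Δ(φ(u_{e₁−e₂}(z)))_w = 1`**. [cite: Kudla1994, §3] -/
theorem detDelta_frameConj_uMinus (z : UnitaryGroup.LocalRing E v) (w : PlacesOver E v) :
    detDelta F E c v 2 w (FrameTransport.frameConj F E c v (2 + 2) hJ₂D (antidiagonal_over_eq_map F E 2) Q hQ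
      (toLocalFour F E c v (uMinus (UnitaryGroup.LocalRing E v) (UnitaryGroup.conjLocal E c v) (UnitaryGroup.conjLocal_conjLocal c v hcδ hδ) z))) = 1 := by
  rw [detDelta_frameConj_of_blocks F E c v hJ₂D D Dinv hDD Q hQm hQ _ _ _ (reindex_uMinus F E c hcδ hδ v z) w, Matrix.det_fin_two_of]
  simp

omit [Algebra.IsQuadraticExtension F E] in
include hJ₂D hDD hQm in
/-- **`adapt (matA (φ(w₁))) = diag(W, D_v W Dinv_v)`**, `W = antidiag(1,1)`. [cite: HarrisKudlaSweet1996, §1 (1.12)] [cite: Casselman1980, §3] -/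
theorem adapt_matA_frameConj_weylOne :
    adapt (matA F E c v 2 (FrameTransport.frameConj F E c v (2 + 2) hJ₂D (antidiagonal_over_eq_map F E 2) Q hQ
        (toLocalFour F E c v (weylOne (UnitaryGroup.LocalRing E v) (UnitaryGroup.conjLocal E c v))))) =
      Matrix.fromBlocks !![0, 1; 1, 0] 0 0
        (D.map ((UnitaryGroup.toLocalRing E v).comp (algebraMap F (v.adicCompletion F))) * !![0, 1; 1, 0] *
          Dinv.map ((UnitaryGroup.toLocalRing E v).comp (algebraMap F (v.adicCompletion F)))) :=
  adapt_matA_frameConj_of_blocks F E c v hJ₂D D Dinv hDD Q hQm hQ _ _ _ (reindex_weylOne F E c v)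

omit [Algebra.IsQuadraticExtension F E] in
include hJ₂D hDD hQm in
/-- **`det_Δ(φ(w₁))_w = −1`**. [cite: Kudla1994, §3] -/
theorem detDelta_frameConj_weylOne (w : PlacesOver E v) :
    detDelta F E c v 2 w (FrameTransport.frameConj F E c v (2 + 2) hJ₂D (antidiagonal_over_eq_map F E 2) Q hQ
      (toLocalFour F E c v (weylOne (UnitaryGroup.LocalRing E v) (UnitaryGroup.conjLocal E c v)))) = -1 := by
  rw [detDelta_frameConj_of_blocks F E c v hJ₂D D Dinv hDD Q hQm hQ _ _ _ (reindex_weylOne F E c v) w, Matrix.det_fin_two_of]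
  simp

/-! ## §3 `φ(w₂)` is the rank-one cell: a flip of the second line times a diagonal Levi element -/

omit [Algebra.IsQuadraticExtension F E] in
include hJ₂D hDD hQm in
/-- **`adapt (matA (φ(w₂))) = ((E₁₁, E₂₁·Dinv_v), (D_v·E₁₂, D_v·E₂₂·Dinv_v))`** for a general frame `D` — its `C`-block `D_v E₁₂` has rank one: `φ(w₂)` lies in the
rank-one cell `P_Δ w₁ P_Δ`, neither in `P_Δ` nor in the big cell `P_Δ w_Δ P_Δ`. [cite: HarrisKudlaSweet1996, §1 (1.12)] [cite: Casselman1980, §3] -/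
theorem adapt_matA_frameConj_weylTwo :
    adapt (matA F E c v 2 (FrameTransport.frameConj F E c v (2 + 2) hJ₂D (antidiagonal_over_eq_map F E 2) Q hQ
        (toLocalFour F E c v (weylTwo (UnitaryGroup.LocalRing E v) (UnitaryGroup.conjLocal E c v))))) =
      Matrix.fromBlocks !![1, 0; 0, 0] (!![0, 0; 1, 0] * Dinv.map ((UnitaryGroup.toLocalRing E v).comp (algebraMap F (v.adicCompletion F))))
        (D.map ((UnitaryGroup.toLocalRing E v).comp (algebraMap F (v.adicCompletion F))) * !![0, 1; 0, 0])
        (D.map ((UnitaryGroup.toLocalRing E v).comp (algebraMap F (v.adicCompletion F))) * !![0, 0; 0, 1] *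
          Dinv.map ((UnitaryGroup.toLocalRing E v).comp (algebraMap F (v.adicCompletion F)))) := by
  rw [adapt_matA_frameConj F E c v 2 hJ₂D D Dinv hDD Q hQm hQ, matS_toLocalFour, reindex_weylTwo, Matrix.fromBlocks_multiply,
    Matrix.fromBlocks_multiply]
  simp only [Matrix.mul_one, Matrix.one_mul, Matrix.mul_zero, Matrix.zero_mul, add_zero, zero_add]

section Antidiag

variable {d₁ d₂ e₁ e₂ : F} (hDa : D = !![0, d₁; d₂, 0]) (hDia : Dinv = !![0, e₁; e₂, 0])

omit [NumberField F] [Algebra.IsQuadraticExtension F E] in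
include hDD hDa hDia in
/-- at an antidiagonal frame `D Dinv = 1` reads `d₁ e₂ = 1` (and `d₂ e₁ = 1`). [folklore] -/
theorem d₁_mul_e₂ : d₁ * e₂ = 1 := by
  have h := congrFun (congrFun hDD 0) 0
  rw [hDa, hDia] at h
  simpa [Matrix.mul_apply, Fin.sum_univ_two] using h

omit [Algebra.IsQuadraticExtension F E] in
include hJ₂D hDD hQm hDa hDia in
/-- **AT AN ANTIDIAGONAL FRAME `D = (0 d₁; d₂ 0)`, `Dinv = (0 e₁; e₂ 0)`** (the shape of `D = ½T₂⁻¹W` for a DIAGONAL `T₂`):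
**`adapt (matA (φ(w₂))) = [[1 − P, e₁·P], [d₂·P, 1 − P]]`, `P = E₂₂`** — a flip of the SECOND line up to the diagonal Levi `diag(1−P+d₂P, 1−P+e₁P)`.
[cite: HarrisKudlaSweet1996, §1 (1.12), (1.15)] [cite: Kudla1994, §3] -/
theorem adapt_matA_frameConj_weylTwo_of_antidiag :
    adapt (matA F E c v 2 (FrameTransport.frameConj F E c v (2 + 2) hJ₂D (antidiagonal_over_eq_map F E 2) Q hQ
        (toLocalFour F E c v (weylTwo (UnitaryGroup.LocalRing E v) (UnitaryGroup.conjLocal E c v))))) =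
      Matrix.fromBlocks !![1, 0; 0, 0]
        !![0, 0; 0, (UnitaryGroup.toLocalRing E v).comp (algebraMap F (v.adicCompletion F)) e₁]
        !![0, 0; 0, (UnitaryGroup.toLocalRing E v).comp (algebraMap F (v.adicCompletion F)) d₂]
        !![1, 0; 0, 0] := by
  have h12 := d₁_mul_e₂ F D Dinv hDD hDa hDia
  rw [adapt_matA_frameConj_weylTwo F E c v hJ₂D D Dinv hDD Q hQm hQ, hDa, hDia]
  set φ : F →+* UnitaryGroup.LocalRing E v := (UnitaryGroup.toLocalRing E v).comp (algebraMap F (v.adicCompletion F)) with hφ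
  congr 1
  · ext i j; fin_cases i <;> fin_cases j <;> simp [Matrix.mul_apply, Fin.sum_univ_two]
  · ext i j; fin_cases i <;> fin_cases j <;> simp [Matrix.mul_apply, Fin.sum_univ_two]
  · -- `D_v E₂₂ Dinv_v = E₁₁`: compute over `F` (`d₁ e₂ = 1`), then map
    rw [show (!![0, 0; 0, 1] : Matrix (Fin 2) (Fin 2) (UnitaryGroup.LocalRing E v)) = (!![0, 0; 0, 1] : Matrix (Fin 2) (Fin 2) F).map φ by
          ext i j; fin_cases i <;> fin_cases j <;> simp,
      ← Matrix.map_mul, ← Matrix.map_mul]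
    have hF : (!![0, d₁; d₂, 0] : Matrix (Fin 2) (Fin 2) F) * !![0, 0; 0, 1] * !![0, e₁; e₂, 0] = !![1, 0; 0, 0] := by
      ext i j; fin_cases i <;> fin_cases j <;> simp [Matrix.mul_apply, Fin.sum_univ_two, h12]
    rw [hF]
    ext i j; fin_cases i <;> fin_cases j <;> simp

omit [Algebra.IsQuadraticExtension F E] in
/-- a flip squares to one: `adapt (matA w₁) = [[1−P, P], [P, 1−P]]` with `P = E₂₂` ⇒ `w₁ · w₁ = 1`. [cite: Kudla1994, §3] -/
theorem flip_mul_self (w₁ : UnitaryGroup.localPi E c (2 + 2) J₂D v)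
    (hw₁ : adapt (matA F E c v 2 w₁) = Matrix.fromBlocks !![1, 0; 0, 0] !![0, 0; 0, 1] !![0, 0; 0, 1] !![1, 0; 0, 0]) : w₁ * w₁ = 1 := by
  refine matA_injective F E c v 2 (eq_of_adapt_eq ?_)
  rw [← matA_mul, adapt_mul, hw₁, matA_one, adapt_one, Matrix.fromBlocks_multiply, ← Matrix.fromBlocks_one]
  congr 1 <;> ext i j <;> fin_cases i <;> fin_cases j <;> simp

omit [Algebra.IsQuadraticExtension F E] in
include hJ₂D hDD hQm hDa hDia in
/-- **`φ(w₂) = w₁ · m` WITH `m` DIAGONAL LEVI**: for any flip `w₁` of the second line, `adapt (matA (w₁ · φ(w₂))) = diag(1 − P + d₂P, 1 − P + e₁P)` (so `φ(w₂) = w₁ · (w₁ · φ(w₂))`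
by `flip_mul_self`, and the right factor is in `M_Δ(F_v)`). [cite: HarrisKudlaSweet1996, §1 (1.12), (1.15)] [cite: Kudla1994, §3] -/
theorem adapt_matA_flip_mul_frameConj_weylTwo (w₁ : UnitaryGroup.localPi E c (2 + 2) J₂D v)
    (hw₁ : adapt (matA F E c v 2 w₁) = Matrix.fromBlocks !![1, 0; 0, 0] !![0, 0; 0, 1] !![0, 0; 0, 1] !![1, 0; 0, 0]) :
    adapt (matA F E c v 2 (w₁ * FrameTransport.frameConj F E c v (2 + 2) hJ₂D (antidiagonal_over_eq_map F E 2) Q hQ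
        (toLocalFour F E c v (weylTwo (UnitaryGroup.LocalRing E v) (UnitaryGroup.conjLocal E c v))))) =
      Matrix.fromBlocks !![1, 0; 0, (UnitaryGroup.toLocalRing E v).comp (algebraMap F (v.adicCompletion F)) d₂] 0 0
        !![1, 0; 0, (UnitaryGroup.toLocalRing E v).comp (algebraMap F (v.adicCompletion F)) e₁] := by
  rw [← matA_mul, adapt_mul, hw₁, adapt_matA_frameConj_weylTwo_of_antidiag F E c v hJ₂D D Dinv hDD Q hQm hQ hDa hDia, Matrix.fromBlocks_multiply]
  congr 1 <;> ext i j <;> fin_cases i <;> fin_cases j <;> simp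

include hJ₂D hDD hQm hDa hDia hcδ hδ hd hT₂ in
/-- **`w₁ · φ(w₂) ∈ P_Δ(F_v)`** (and `B = 0`: a Levi element) for any flip `w₁` of the second line. [cite: HarrisKudlaSweet1996, §1 (1.12)] [cite: Kudla1994, §3] -/
theorem isSiegelDelta_flip_mul_frameConj_weylTwo (w₁ : UnitaryGroup.localPi E c (2 + 2) J₂D v)
    (hw₁ : adapt (matA F E c v 2 w₁) = Matrix.fromBlocks !![1, 0; 0, 0] !![0, 0; 0, 1] !![0, 0; 0, 1] !![1, 0; 0, 0]) :
    IsSiegelDelta F E c hcδ hδ hd v 2 hT₂ hJ₂D (w₁ * FrameTransport.frameConj F E c v (2 + 2) hJ₂D (antidiagonal_over_eq_map F E 2) Q hQ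
        (toLocalFour F E c v (weylTwo (UnitaryGroup.LocalRing E v) (UnitaryGroup.conjLocal E c v)))) ∧
      blkB (matA F E c v 2 (w₁ * FrameTransport.frameConj F E c v (2 + 2) hJ₂D (antidiagonal_over_eq_map F E 2) Q hQ
        (toLocalFour F E c v (weylTwo (UnitaryGroup.LocalRing E v) (UnitaryGroup.conjLocal E c v))))) = 0 := by
  have h := adapt_matA_flip_mul_frameConj_weylTwo F E c v hJ₂D D Dinv hDD Q hQm hQ hDa hDia w₁ hw₁
  rw [adapt_eq] at h
  obtain ⟨-, hB, hC, -⟩ := Matrix.fromBlocks_inj.1 h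
  exact ⟨(isSiegelDelta_iff_blkC_eq_zero F E c hcδ hδ hd v 2 hT₂ hJ₂D _).2 hC, hB⟩

end Antidiag

end Summit.HodgeConjecture.HodgeConjecture.Cruxes.HLiu418.K2LiuLocalFourCornerFactorisation

end
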